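import Summits.RiemannHypothesis.RiemannHypothesis.Theses.WeilWindowFlow
import Literature.NumberTheory.LFunctions.WeilWindowSuzukiContinuityProofs
import Literature.NumberTheory.LFunctions.WeilWindowSuzukiProofs
import HarnessLib

/-!
# `LipschitzDerivGlue` for route WeilWindowFlow (item stmt-RiemannHypothesis-14755)

**What is proved.** The route decl
`Summit.RiemannHypothesis.RiemannHypothesis.Theses.WeilWindowFlow.LipschitzDerivGlue`, i.e.
`WindowLipschitz → DerivLeakage → DiniLeakage`, for the window bottom `ε = weilGroundEnergy`.

**Proof.**
1. *Abstract Grönwall for Lipschitz functions* (`mul_exp_le_of_lipschitzOnWith`): if `f` is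
   Lipschitz on `[b, c]` and `-f' ≤ K f` at every interior point where `f` is differentiable, then
   `f b · e^{-K (c - b)} ≤ f c`. Indeed `F = f · e^{K·}` is absolutely continuous
   (`LipschitzOnWith.absolutelyContinuousOnInterval`, product with a `C¹` function), `F' ≥ 0` at
   a.e. point (`AbsolutelyContinuousOnInterval.ae_differentiableAt`), and the fundamental theorem of
   calculus for absolutely continuous functions (`AbsolutelyContinuousOnInterval.integral_deriv_eq_sub`)
   gives `F b ≤ F c`. A first-conjugate-point argument (`pos_of_lipschitzOnWith`) upgrades this to:
   `f b > 0` and the derivative bound at the POSITIVE differentiability points force `f > 0` on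
   `[b, c]`.
2. *The window bottom.* `ε` is antitone on `(0, ∞)` (larger window, smaller infimum), so the
   one-sided bound of `WindowLipschitz` makes `ε` Lipschitz on every `[b₀, A] ⊂ (0, ∞)`; with the
   anchor `exists_weilGroundEnergy_pos` (`ε > 0` on small windows, Bombieri 2000 Thm 12) and
   `DerivLeakage`, step 1 gives `ε > 0` on all of `(0, ∞)`.
3. *Dini form.* On `[b₀, A]` let `m = min ε > 0` (continuity, `continuousAt_weilGroundEnergy`) and
   `L` a `WindowLipschitz` constant on `[b₀, A + 1]`; for `h = min δ 1 / 2`,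
   `ε a − ε (a + h) ≤ L h ≤ h · (max L 0 / m) · ε a`, which is `DiniLeakage` with `K = max L 0 / m`.

No named facts are assumed; axioms ⊆ {propext, Classical.choice, Quot.sound}.
-/

-- `Summit.RiemannHypothesis.RiemannHypothesis.…` repeats a namespace component by design (D-0017).
set_option linter.dupNamespace false

noncomputable section

open MeasureTheory Set Filter intervalIntegral
open scoped Topology NNReal

namespace Summit.RiemannHypothesis.RiemannHypothesis.Theorems.WeilWindowFlowLipschitzDerivGlue

open Literature.NumberTheory.LFunctions
open Summit.RiemannHypothesis.RiemannHypothesis.Theses.WeilWindowFlow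

/-! ## 1. Abstract real analysis: Grönwall for Lipschitz functions from an a.e. derivative bound -/

/-- **Grönwall for a Lipschitz function.** If `f` is Lipschitz on `[b, c]` and
`-f' x ≤ K · f x` at every `x ∈ (b, c)` where `f` is differentiable, then
`f b · exp (−K (c − b)) ≤ f c`. (FTC for the absolutely continuous function `f · e^{K·}`, whose
derivative is a.e. nonnegative.) [folklore] -/
theorem mul_exp_le_of_lipschitzOnWith {f : ℝ → ℝ} {b c K : ℝ} {L : ℝ≥0} (hbc : b ≤ c)
    (hf : LipschitzOnWith L f (Icc b c))
    (hD : ∀ x ∈ Ioo b c, DifferentiableAt ℝ f x → -deriv f x ≤ K * f x) :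
    f b * Real.exp (-(K * (c - b))) ≤ f c := by
  -- `F = f · exp (K ·)` is absolutely continuous on `[b, c]`
  have hfac : AbsolutelyContinuousOnInterval f b c := by
    refine LipschitzOnWith.absolutelyContinuousOnInterval (K := L) ?_
    rwa [uIcc_of_le hbc]
  have heac : AbsolutelyContinuousOnInterval (fun x ↦ Real.exp (K * x)) b c := by
    refine ContDiffOn.absolutelyContinuousOnInterval ?_
    have h : ContDiff ℝ 1 (fun x : ℝ ↦ Real.exp (K * x)) := by fun_prop
    exact h.contDiffOn
  have hFac : AbsolutelyContinuousOnInterval (fun x ↦ f x * Real.exp (K * x)) b c :=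
    hfac.fun_mul heac
  -- its derivative is nonnegative at a.e. point of `(b, c)`
  have hae : ∀ᵐ x, x ∈ Ioo b c → 0 ≤ deriv (fun y ↦ f y * Real.exp (K * y)) x := by
    filter_upwards [hfac.ae_differentiableAt] with x hx hxI
    have hxu : x ∈ uIcc b c := by
      rw [uIcc_of_le hbc]
      exact Ioo_subset_Icc_self hxI
    have hfd : DifferentiableAt ℝ f x := hx hxu
    have hed : HasDerivAt (fun y : ℝ ↦ Real.exp (K * y)) (Real.exp (K * x) * K) x := by
      have h1 : HasDerivAt (fun y : ℝ ↦ K * y) K x := by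
        simpa using (hasDerivAt_id x).const_mul K
      exact h1.exp
    have hFd := hfd.hasDerivAt.fun_mul hed
    rw [hFd.deriv]
    have h2 := hD x hxI hfd
    have h3 : 0 ≤ (deriv f x + K * f x) * Real.exp (K * x) :=
      mul_nonneg (by linarith) (Real.exp_pos _).le
    have h4 : deriv f x * Real.exp (K * x) + f x * (Real.exp (K * x) * K)
        = (deriv f x + K * f x) * Real.exp (K * x) := by ring
    rw [h4]
    exact h3
  -- FTC for absolutely continuous functions
  have hint : 0 ≤ ∫ x in b..c, deriv (fun y ↦ f y * Real.exp (K * y)) x := by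
    apply intervalIntegral.integral_nonneg_of_ae_restrict hbc
    rw [← Measure.restrict_congr_set (Ioo_ae_eq_Icc (μ := volume) (a := b) (b := c)),
      Filter.EventuallyLE, ae_restrict_iff' measurableSet_Ioo]
    filter_upwards [hae] with x hx hxI
    exact hx hxI
  rw [hFac.integral_deriv_eq_sub] at hint
  have h5 : f b * Real.exp (K * b) ≤ f c * Real.exp (K * c) := by linarith
  have h7 : Real.exp (K * b) * Real.exp (-(K * c)) = Real.exp (-(K * (c - b))) := by
    rw [← Real.exp_add]
    congr 1
    ring
  have h8 : Real.exp (K * c) * Real.exp (-(K * c)) = 1 := by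
    rw [← Real.exp_add]
    simp
  have h9 := mul_le_mul_of_nonneg_right h5 (Real.exp_pos (-(K * c))).le
  calc f b * Real.exp (-(K * (c - b)))
        = f b * Real.exp (K * b) * Real.exp (-(K * c)) := by rw [mul_assoc, h7]
    _ ≤ f c * Real.exp (K * c) * Real.exp (-(K * c)) := h9
    _ = f c := by rw [mul_assoc, h8, mul_one]

/-- **No conjugate point at a finite relative rate (Lipschitz version).** If `f` is Lipschitz on
`[b, c]`, `f b > 0`, and `-f' x ≤ K · f x` at every `x ∈ (b, c)` where `f` is differentiable AND
positive, then `f > 0` on all of `[b, c]`: at a first zero `a`, Grönwall on `[b, a]`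
(`mul_exp_le_of_lipschitzOnWith`) would give `f a ≥ f b · e^{−K (a − b)} > 0`. [folklore] -/
theorem pos_of_lipschitzOnWith {f : ℝ → ℝ} {b c K : ℝ} {L : ℝ≥0}
    (hf : LipschitzOnWith L f (Icc b c)) (hb : 0 < f b)
    (hD : ∀ x ∈ Ioo b c, 0 < f x → DifferentiableAt ℝ f x → -deriv f x ≤ K * f x) :
    ∀ x ∈ Icc b c, 0 < f x := by
  by_contra hneg
  push Not at hneg
  -- the closed, nonempty set of bad points and its infimum `a` (the first conjugate point)
  set S : Set ℝ := Icc b c ∩ f ⁻¹' (Iic 0) with hS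
  have hSne : S.Nonempty := by
    obtain ⟨x, hx, hfx⟩ := hneg
    exact ⟨x, hx, hfx⟩
  have hScl : IsClosed S :=
    hf.continuousOn.preimage_isClosed_of_isClosed isClosed_Icc isClosed_Iic
  have hSbdd : BddBelow S := ⟨b, fun x hx ↦ hx.1.1⟩
  have haS : sInf S ∈ S := hScl.csInf_mem hSne hSbdd
  have hba : b ≤ sInf S := haS.1.1
  have hac : sInf S ≤ c := haS.1.2
  have hfa : f (sInf S) ≤ 0 := haS.2
  -- before `a`, `f` is positive
  have hpos : ∀ x ∈ Ico b (sInf S), 0 < f x := by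
    intro x hx
    by_contra hx0
    push Not at hx0
    have hxS : x ∈ S := ⟨⟨hx.1, hx.2.le.trans hac⟩, hx0⟩
    have := csInf_le hSbdd hxS
    linarith [hx.2]
  -- Grönwall on `[b, a]`
  have key := mul_exp_le_of_lipschitzOnWith (K := K) hba (hf.mono (Icc_subset_Icc_right hac))
    (fun x hx hdx ↦ hD x ⟨hx.1, lt_of_lt_of_le hx.2 hac⟩ (hpos x ⟨hx.1.le, hx.2⟩) hdx)
  have : 0 < f b * Real.exp (-(K * (sInf S - b))) := mul_pos hb (Real.exp_pos _)
  linarith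

/-! ## 2. The window bottom: antitone, hence Lipschitz under `WindowLipschitz`; positivity -/

/-- `ε` is antitone on `(0, ∞)`: a larger window has a larger unit sphere of test functions, hence
a smaller infimum (the spheres are nonempty, `exists_isWeilTest_sphere`, and the energies bounded
below, `bddBelow_weilQuadratic_sphere_holds`). [folklore] -/
theorem weilGroundEnergy_antitoneOn : AntitoneOn weilGroundEnergy (Ioi 0) := by
  intro b hb a _ hba
  obtain ⟨g, hg, hs, hn⟩ := exists_isWeilTest_sphere (a := b) hb
  refine csInf_le_csInf (bddBelow_weilQuadratic_sphere_holds a) ⟨_, g, hg, hs, hn, rfl⟩ ?_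
  rintro x ⟨g', hg', hs', hn', rfl⟩
  exact ⟨g', hg', hs'.trans (Icc_subset_Icc (neg_le_neg hba) hba), hn', rfl⟩

/-- Under `WindowLipschitz`, `ε` is Lipschitz on every compact window range `[b₀, A] ⊂ (0, ∞)`:
the decrease is bounded by `WindowLipschitz`, and `ε` never increases (antitone). [folklore] -/
theorem lipschitzOnWith_of_windowLipschitz (hW : WindowLipschitz) {b₀ A : ℝ} (hb₀ : 0 < b₀)
    (hA : b₀ ≤ A) : ∃ L : ℝ≥0, LipschitzOnWith L weilGroundEnergy (Icc b₀ A) := by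
  obtain ⟨L, hL⟩ := hW b₀ A hb₀ hA
  refine ⟨Real.toNNReal (max L 0), LipschitzOnWith.of_le_add_mul' (max L 0) ?_⟩
  intro x hx y hy
  rcases le_total x y with hxy | hxy
  · have h1 := hL x y hx.1 hxy hy.2
    have h2 : dist x y = y - x := by
      rw [Real.dist_eq, abs_sub_comm, abs_of_nonneg (by linarith)]
    rw [h2]
    have h3 : L * (y - x) ≤ max L 0 * (y - x) :=
      mul_le_mul_of_nonneg_right (le_max_left _ _) (by linarith)
    linarith
  · have h1 : weilGroundEnergy x ≤ weilGroundEnergy y :=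
      weilGroundEnergy_antitoneOn (lt_of_lt_of_le hb₀ hy.1) (lt_of_lt_of_le hb₀ hx.1) hxy
    have h2 : 0 ≤ max L 0 * dist x y := mul_nonneg (le_max_right _ _) dist_nonneg
    linarith

/-- **No conjugate point along the window.** Under `WindowLipschitz` and `DerivLeakage` the window
bottom is strictly positive at every window `x > 0`: anchor `exists_weilGroundEnergy_pos`
(`ε > 0` on `(0, a₁]`, Bombieri 2000 Thm 12), then the Lipschitz Grönwall/first-zero argument
`pos_of_lipschitzOnWith` on `[a₁, x]`. [folklore] -/
theorem weilGroundEnergy_pos_of_windowLipschitz_of_derivLeakage (hW : WindowLipschitz)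
    (hD : DerivLeakage) {x : ℝ} (hx : 0 < x) : 0 < weilGroundEnergy x := by
  obtain ⟨a₁, ha₁, hpos⟩ := exists_weilGroundEnergy_pos
  by_cases hle : x ≤ a₁
  · exact hpos x hx hle
  have hlt : a₁ ≤ x := (lt_of_not_ge hle).le
  obtain ⟨L, hL⟩ := lipschitzOnWith_of_windowLipschitz hW ha₁ hlt
  obtain ⟨K, hK⟩ := hD a₁ x ha₁ hlt
  exact pos_of_lipschitzOnWith hL (hpos a₁ ha₁ le_rfl)
    (fun y hy hfy hdy ↦ hK y hy.1.le hy.2.le hfy hdy) x (right_mem_Icc.2 hlt)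

/-! ## 3. The Dini form: the glue -/

/-- **`LipschitzDerivGlue`** (item stmt-RiemannHypothesis-14755 of route WeilWindowFlow):
`WindowLipschitz → DerivLeakage → DiniLeakage`. Positivity of the window bottom on `(0, ∞)` is
`weilGroundEnergy_pos_of_windowLipschitz_of_derivLeakage` (a.e. Grönwall for the absolutely
continuous product `ε · e^{K·}` from the coercive anchor). Dini form: on `[b₀, A]` take
`K = max L 0 / m`, `m = min_{[b₀, A]} ε > 0` (continuity of `ε`, `continuousAt_weilGroundEnergy`,
on a compact range) and `L` a `WindowLipschitz` constant on `[b₀, A + 1]`; the witness step is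
`h = min δ 1 / 2`, for which `ε a − ε (a + h) ≤ L h ≤ h (K ε a) ≤ h (K ε a + η)`. [folklore] -/
theorem lipschitzDerivGlue_proof : LipschitzDerivGlue := by
  unfold LipschitzDerivGlue DiniLeakage
  intro hW hD b₀ A hb₀ hA
  have hpos : ∀ a : ℝ, 0 < a → 0 < weilGroundEnergy a :=
    fun a ha ↦ weilGroundEnergy_pos_of_windowLipschitz_of_derivLeakage hW hD ha
  obtain ⟨L, hL⟩ := hW b₀ (A + 1) hb₀ (by linarith)
  have hcont : ContinuousOn weilGroundEnergy (Icc b₀ A) :=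
    fun y hy ↦ (continuousAt_weilGroundEnergy (lt_of_lt_of_le hb₀ hy.1)).continuousWithinAt
  obtain ⟨a₀, ha₀, hmin⟩ :=
    (isCompact_Icc (a := b₀) (b := A)).exists_isMinOn (nonempty_Icc.2 hA) hcont
  have hm : 0 < weilGroundEnergy a₀ := hpos a₀ (lt_of_lt_of_le hb₀ ha₀.1)
  refine ⟨max L 0 / weilGroundEnergy a₀, fun a ha haA η δ hη hδ ↦ ?_⟩
  refine ⟨min δ 1 / 2, by positivity, by have := min_le_left δ 1; linarith, ?_⟩
  have h1 : min δ 1 / 2 ≤ 1 / 2 := by have := min_le_right δ 1; linarith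
  have hh : 0 < min δ 1 / 2 := by positivity
  have h2 := hL a (a + min δ 1 / 2) ha (by linarith) (by linarith)
  have h3 : weilGroundEnergy a₀ ≤ weilGroundEnergy a := hmin ⟨ha, haA⟩
  have hK0 : 0 ≤ max L 0 / weilGroundEnergy a₀ := div_nonneg (le_max_right _ _) hm.le
  have h4 : L ≤ max L 0 / weilGroundEnergy a₀ * weilGroundEnergy a :=
    calc L ≤ max L 0 := le_max_left _ _
      _ = max L 0 / weilGroundEnergy a₀ * weilGroundEnergy a₀ := by field_simp
      _ ≤ max L 0 / weilGroundEnergy a₀ * weilGroundEnergy a :=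
          mul_le_mul_of_nonneg_left h3 hK0
  have h5 : L * (a + min δ 1 / 2 - a) = min δ 1 / 2 * L := by ring
  rw [h5] at h2
  calc weilGroundEnergy a - weilGroundEnergy (a + min δ 1 / 2) ≤ min δ 1 / 2 * L := h2
    _ ≤ min δ 1 / 2 * (max L 0 / weilGroundEnergy a₀ * weilGroundEnergy a + η) :=
        mul_le_mul_of_nonneg_left (by linarith) hh.le

end Summit.RiemannHypothesis.RiemannHypothesis.Theorems.WeilWindowFlowLipschitzDerivGlue

end
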